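import Summits.Ventures.Crystal3D.Theorems.StickyWulffConstantCoaxialWallLawWordRigidity
import HarnessLib

/-!
# The 3-adic position invariant of the word automaton: every move direction lies in `3^{-k}·Λ₀` over the bottom frame

HONEST FRAMING. Part of the venture `Summits/Ventures/Crystal3D` (cell `crystal3d-full`), helper for the crux
`CoaxialWallLaw` (stmt-Ventures-19481) of `route-Ventures-StickyWulffConstant`, REGISTERED line `WallLedgerF`
(planner cf-p1 gen 16), open stub `stub_coaxialTwoSlabAdhesion` (general fillings).  Input of the band-free NET
count for 3-ADICALLY GENERIC TRANSLATION pairs (`word_sources_le_lists_stateInv`, `…WordInstanceStateInv`): the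
balls visited by 19481-p2's word automaton rooted at the bottom frame `G₀` all lie in `s₁ + G₀(ℤ[1/3]·Λ₀)`, because
a mirror across a model `{111}` plane divides the lattice by at most `3`.  Rung credit only; F-C1 not moved.

* `triadic_reflect` — for a unit model menu normal `μ` (`√6 μ ∈ Λ₀`, `⟪w, √6 μ⟫ ∈ ℤ` on `Λ₀`,
  `sqrt6_smul_menuNormal_mem`) and `3^j x ∈ Λ₀`: `3^{j+1} (x − 2⟪x, μ⟫ μ) ∈ Λ₀`
  (`3^{j+1} R_μ x = 3·(3^j x) − ⟪3^j x, √6 μ⟫·(√6 μ)`).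
* `triadic_foldl` — along a list of unit model menu normals the mirror chain maps `3^{-j}Λ₀` into
  `3^{-(j + length)}Λ₀`.
* `word_dir_triadic` — for the word classes of `…WordLetters` (`F (μ :: κ) = F κ ∘ R_μ`, `u κ` a slot) over the
  bottom frame `F []`: the direction of a well-formed word satisfies `3^{|κ|} · F κ (u κ) = F [] q` for some
  `q ∈ Λ₀`.

WHAT THIS IS NOT: not the stub; F-C1 not moved.
-/

noncomputable section

namespace Summit.Ventures.Crystal3D.Theorems

open Summit.Ventures.Crystal3D Finset
open Literature.MathematicalPhysics.StatisticalMechanics (fccStacking barlowStacking constHagg)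
open Literature.Barriers.AtomisticToContinuum (barlowAddSubgroupOfConst)
open scoped InnerProductSpace

/-- Integer multiples of lattice vectors are lattice vectors. -/
theorem fcc_zsmul_mem (z : ℤ) {x : EuclideanSpace ℝ (Fin 3)} (hx : x ∈ fccStacking 1 (Real.sqrt (2 / 3))) :
    (z : ℝ) • x ∈ fccStacking 1 (Real.sqrt (2 / 3)) := by
  set G₁ : AddSubgroup (EuclideanSpace ℝ (Fin 3)) :=
    barlowAddSubgroupOfConst 1 (Real.sqrt (2 / 3)) constHagg (fun _ => rfl) with hG₁
  have hG₁mem : ∀ w, w ∈ G₁ ↔ w ∈ fccStacking 1 (Real.sqrt (2 / 3)) := fun w => Iff.rfl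
  have := G₁.zsmul_mem ((hG₁mem x).2 hx) z
  rw [hG₁mem] at this
  rw [← Int.cast_smul_eq_zsmul ℝ] at this
  exact this

/-- **A model mirror divides the lattice by at most three.**  See the module docstring. -/
theorem triadic_reflect {μ x : EuclideanSpace ℝ (Fin 3)} (hμ : ‖μ‖ = 1)
    (hmenu : ∀ w ∈ fccSlots, ⟪w, μ⟫_ℝ = 0 ∨ ⟪w, μ⟫_ℝ = Real.sqrt (2 / 3) ∨ ⟪w, μ⟫_ℝ = -Real.sqrt (2 / 3))
    {j : ℕ} (hx : ((3 : ℝ) ^ j) • x ∈ fccStacking 1 (Real.sqrt (2 / 3))) :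
    ((3 : ℝ) ^ (j + 1)) • (x - (2 * ⟪x, μ⟫_ℝ) • μ) ∈ fccStacking 1 (Real.sqrt (2 / 3)) := by
  obtain ⟨hax, hint⟩ := sqrt6_smul_menuNormal_mem hμ hmenu
  obtain ⟨n, hn⟩ := hint _ hx
  have h66 : Real.sqrt 6 * Real.sqrt 6 = 6 := Real.mul_self_sqrt (by norm_num)
  -- `⟪3^j x, μ⟫ = n / √6`
  have hn' : ((3 : ℝ) ^ j) * ⟪x, μ⟫_ℝ * Real.sqrt 6 = n := by
    rw [← hn, real_inner_smul_left, real_inner_smul_right]; ring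
  -- the identity `3^{j+1} (x − 2⟪x,μ⟫μ) = 3 • (3^j x) + (−n) • (√6 μ)`
  have key : ((3 : ℝ) ^ (j + 1)) • (x - (2 * ⟪x, μ⟫_ℝ) • μ) =
      ((3 : ℤ) : ℝ) • (((3 : ℝ) ^ j) • x) + ((-n : ℤ) : ℝ) • (Real.sqrt 6 • μ) := by
    have e1 : ((-n : ℤ) : ℝ) • (Real.sqrt 6 • μ) = (-(((3 : ℝ) ^ j) * ⟪x, μ⟫_ℝ * Real.sqrt 6) * Real.sqrt 6) • μ := by
      rw [smul_smul]; push_cast; rw [← hn']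
    rw [e1, smul_sub, smul_smul, smul_smul, pow_succ]
    have e2 : -((3 : ℝ) ^ j * ⟪x, μ⟫_ℝ * Real.sqrt 6) * Real.sqrt 6 = -(3 ^ j * ⟪x, μ⟫_ℝ * 6) := by
      linear_combination (-((3 : ℝ) ^ j * ⟪x, μ⟫_ℝ)) * h66
    rw [e2]
    push_cast
    module
  rw [key]
  exact fcc_add_site_mem (fcc_zsmul_mem 3 hx) (fcc_zsmul_mem (-n) hax)

/-- **The mirror chain of a list of unit model menu normals maps `3^{-j}Λ₀` into `3^{-(j+|κ|)}Λ₀`.** -/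
theorem triadic_foldl : ∀ (κ : List (EuclideanSpace ℝ (Fin 3))),
    (∀ μ ∈ κ, ‖μ‖ = 1 ∧
      ∀ w ∈ fccSlots, ⟪w, μ⟫_ℝ = 0 ∨ ⟪w, μ⟫_ℝ = Real.sqrt (2 / 3) ∨ ⟪w, μ⟫_ℝ = -Real.sqrt (2 / 3)) →
    ∀ (j : ℕ) (x : EuclideanSpace ℝ (Fin 3)), ((3 : ℝ) ^ j) • x ∈ fccStacking 1 (Real.sqrt (2 / 3)) →
      ((3 : ℝ) ^ (j + κ.length)) • (κ.foldl (fun (y : EuclideanSpace ℝ (Fin 3)) μ => y - (2 * ⟪y, μ⟫_ℝ) • μ) x) ∈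
        fccStacking 1 (Real.sqrt (2 / 3)) := by
  intro κ
  induction κ with
  | nil => intro _ j x hx; simpa using hx
  | cons μ κ ih =>
    intro hκ j x hx
    obtain ⟨hμ1, hμm⟩ := hκ μ (by simp)
    have hκ' : ∀ ν ∈ κ, ‖ν‖ = 1 ∧
        ∀ w ∈ fccSlots, ⟪w, ν⟫_ℝ = 0 ∨ ⟪w, ν⟫_ℝ = Real.sqrt (2 / 3) ∨ ⟪w, ν⟫_ℝ = -Real.sqrt (2 / 3) :=
      fun ν hν => hκ ν (by simp [hν])
    rw [List.foldl_cons, List.length_cons, show j + (κ.length + 1) = (j + 1) + κ.length by ring]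
    exact ih hκ' (j + 1) _ (triadic_reflect hμ1 hμm hx)

section Word

variable {F : List (EuclideanSpace ℝ (Fin 3)) → (EuclideanSpace ℝ (Fin 3) ≃ₗᵢ[ℝ] EuclideanSpace ℝ (Fin 3))}
  {u : List (EuclideanSpace ℝ (Fin 3)) → EuclideanSpace ℝ (Fin 3)}
  {WF : List (EuclideanSpace ℝ (Fin 3)) → Prop}

/-- **Directions of well-formed words are 3-adic lattice vectors of the bottom frame.**  See the module
docstring. -/
theorem word_dir_triadic (hFc : ∀ μ κ, F (μ :: κ) = ((ℝ ∙ μ)ᗮ.reflection).trans (F κ))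
    (hu : ∀ κ, u κ ∈ fccSlots) (huc : ∀ μ κ, u (μ :: κ) = -u κ)
    (hWFc : ∀ μ κ, WF (μ :: κ) ↔ (WF κ ∧ ‖μ‖ = 1 ∧
      (∀ w ∈ fccSlots, ⟪w, μ⟫_ℝ = 0 ∨ ⟪w, μ⟫_ℝ = Real.sqrt (2 / 3) ∨ ⟪w, μ⟫_ℝ = -Real.sqrt (2 / 3)) ∧
      ⟪u κ, μ⟫_ℝ = Real.sqrt (2 / 3) ∧ ∀ μ' κ', κ = μ' :: κ' → μ' ≠ -μ))
    {κ : List (EuclideanSpace ℝ (Fin 3))} (hκ : WF κ) :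
    ∃ q ∈ fccStacking 1 (Real.sqrt (2 / 3)), ((3 : ℝ) ^ κ.length) • F κ (u κ) = F [] q := by
  obtain ⟨hlet, -⟩ := word_letters_of_wf huc hWFc κ hκ
  have hκu : ∀ μ ∈ κ, ‖μ‖ = 1 := fun μ hμ => (hlet μ hμ).1
  have happ : F κ (u κ) = F [] (κ.foldl (fun (y : EuclideanSpace ℝ (Fin 3)) μ => y - (2 * ⟪y, μ⟫_ℝ) • μ) (u κ)) := by
    have := word_F_append_apply hFc κ hκu [] (u κ)
    rwa [List.append_nil] at this
  have h0 : ((3 : ℝ) ^ 0) • u κ ∈ fccStacking 1 (Real.sqrt (2 / 3)) := by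
    rw [pow_zero, one_smul]; exact mem_fcc_of_mem_fccSlots (hu κ)
  have h1 := triadic_foldl κ hlet 0 (u κ) h0
  rw [zero_add] at h1
  refine ⟨_, h1, ?_⟩
  rw [happ, LinearIsometryEquiv.map_smul]

end Word

end Summit.Ventures.Crystal3D.Theorems

end
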